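import Summits.QuantumFields.BalabanUV.Beta.D1BFx.GhostStencilReflectionQ
import Summits.QuantumFields.BalabanUV.Beta.D1BFx.GhostStencilWard

/-!
# `BalabanUV.Beta.D1BFx.GhostStencilDivergence` — road «BF-x» for binder row D1, sub-leaf A4-leg-PARITY-gh (part 5a): THE PURE-GAUGE
# DIVERGENCE OF T6 v1's FIRST-ORDER GHOST STENCIL IS A COMMUTATOR WITH THE GHOST OPERATOR — `divV (Sgh n (c·n²) (c·a)) u =
# c • (O ∘ δ_u − δ_u ∘ O)`, `O` = the site matrix of `Δ^η + a·Q′*Q′` — for EVERY block size (corner rooting included): the algebraic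
# half of the first-order Ward socket (W1) of `FineHessianWard.bondSecondMoment_Pgh_eq_avgM2_of_laws`, plus T6's owed guard-redundancy lemma

HONEST DEPENDENCY (page 1, mandatory): continuum YM on T⁴ ⇐ BetaPertH ∧ nine spine estimates (0/9 proved); BetaPertH ⇐ (D1) ∧ (D4) ∧
CAP+tail; G-an2-4 gates asym, D1 and NE2/3/4.  HONEST FRAMING (cell contract, verbatim): «discharging `BetaPertH` makes Bałaban's UV
stability UNCONDITIONAL — a real constructive-QFT result; it is NOT the continuum limit and NOT the Clay problem.»  THIS FILE DISCHARGES
NOTHING of D1 / BetaPertH: [folklore] finite bookkeeping about the road's OWN typed objects (T6 `ghCur/qJet/qAnti/Sgh`, an1's `axial`,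
T2's site matrix `AX`, part 4's `genX`) and ONE new object (`Oker`, the ghost operator's kernel in the road's `MKer` currency — a
definition by re-indexing, asserting nothing); 0 binders of the hR root are touched; no `def … : Prop`, no citation, nothing printed.
ABSOLUTE RULE (cell charter, verbatim): «No internally-minted statement may enter as a cited fact. Every hypothesis is either
kernel-proved in this package or a verbatim quotation of a PUBLISHED theorem with page reference. The manuscript(s) under audit are NOT
citable for their own disputed steps — they are the thing under adjudication; programme-internal (2001/route/tribunal) claims are never
citable.»

WHY.  The END's socket (W1) `(Ggh ∘ divV (Sgh n cK cQ) u) ∘ Ggh = Ggh ∘ X u − X u ∘ Ggh` is the jet form of gauge covariance of the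
RESOLVENT; it follows (part 5b, `GhostLegWard`) from the OPERATOR statement proved here: the pure-gauge combination of T6's first jets at
the fine site `u` is the commutator of the operator with the site generator.  Unlike the parity socket (parts 2–3), this holds for T6 v1 AS
TYPED — gauge covariance does not see the contour root — and it FIXES THE UNITS: `(cK, cQ) = c·(n², a)` with generator `−c·δ_u`, the
kernel form of the typer's CHECK-N0 reading «`(cK, cQ) = (n², a)` up to sign».
* §1 [folklore] RANGE-AWARE LETTER LEMMA for an1's `axial`: every letter of `Γ_{y,x}` is `±A κ v` with `v` coordinatewise BETWEEN `y` and `x`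
  (`mem_axialAux_between`); hence inside an `n`-block (`blk_of_between`), so **`gammaCoeff_eq_zero_of_blk_ne`** and T6's OWED
  **GUARD-REDUNDANCY LEMMA `qJet_eq_unguarded`**: `qJet n κ v Y w = [blk w = Y]·n⁻⁴·γ(κ,v; n•Y, w)` (the `[blk v = Y]` guard is automatic).
* §2 [folklore] LINEARITY `axial_sum_add/_finset_sum` (from an1's `axial_sum_sub`) and the BOUNDARY IDENTITY: the pure-gauge combination of
  the bond indicator forms at `u` is an1's `grad` of the site indicator (`sum_bondForm_div`), so by `axial_sum_grad`
  **`sum_gammaCoeff_div`**: `Σ_μ (γ(μ, u−e_μ; r, w) − γ(μ, u; r, w)) = [w = u] − [r = u]` (signed entries minus exits of `u` along any contour).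
* §3 [folklore] THE DIVERGENCES: **`div_ghCur_apply`** `Σ_μ (ghCur μ (u−e_μ) − ghCur μ u)(x,z) = lapKer x u·[z = u] − [x = u]·lapKer u z`;
  **`div_qAnti_apply`** `Σ_μ (qAnti n μ (u−e_μ) − qAnti n μ u)(x,z) = n⁻⁴·(sameBlk x u·[z = u] − [x = u]·sameBlk u z)` (the root terms cancel
  in the antisymmetrisation — ANY block size, corner root).
* §4 [our object] `Oker n a x z := AX (n−1) a x z` and [folklore] **`divV_Sgh_eq`**: `divV (Sgh n (c·n²) (c·a)) u = c • (Oker n a ∘ genX u −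
  genX u ∘ Oker n a)` for every real `c`, every `n ≥ 1`, every `a`.
NOT HERE: the resolvent step (part 5b); (W2); the `Q′(U)` second jets; anything printed.  Unit `b2b-balaban-beta-d1-formalise-leaf-01` (gen 3).
-/

noncomputable section

namespace Summit.QuantumFields.BalabanUV.Beta.D1BFx.GhostStencilDivergence

open Finset
open scoped BigOperators
open Literature.MathematicalPhysics.QuantumFieldTheory.Balaban1983to89
open Literature.MathematicalPhysics.QuantumFieldTheory.Balaban1983to89.Beta
open B6QGQLower276 (X e blk side lapDir lapKer sameBlk AX side_facts)
open ExpKernelCalculus (Site MKer comp)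
open AffineAveraging (Form1 unitVec unitVec_apply)
open AveragingContours (grad seg segUp segDown corner axialAux axial axial_self axial_sum_sub axial_sum_grad)
open KernelWard (divV)
open Summit.QuantumFields.BalabanUV.Beta.D1BFx.GhostLeg (side_pred blk_pred_apply blk_translate AX_pred_apply)
open Summit.QuantumFields.BalabanUV.Beta.D1BFx.GhostStencil (bondForm gammaCoeff qJet qAnti qAnti_apply Sgh Sgh_apply ghCur ghCur_apply
  unitVec_ne_zero blk_translate')
open Summit.QuantumFields.BalabanUV.Beta.D1BFx.GhostStencilReflection (add_unitVec_ne_self self_ne_add_unitVec add_unitVec_ne_sub_unitVec)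
open Summit.QuantumFields.BalabanUV.Beta.D1BFx.GhostStencilReflectionQ (blk_zero)
open Summit.QuantumFields.BalabanUV.Beta.D1BFx.GhostStencilWard (genX genX_apply comp_genX_left comp_genX_right unitVec_eq)

/-! ## §1 Range-aware letters; the guard-redundancy lemma -/

/-- [folklore] Letters of a forward segment with their PARAMETER: `a = A κ (z + s•e_κ)` with `s < m` (cons recursion; the mapped
coerced `List.range` is not unfolded). -/
theorem mem_segUp_range {A : Form1 4 ℝ} {z : Site 4} {κ : Fin 4} {a : ℝ} :
    ∀ {m : ℕ}, a ∈ segUp A z κ m → ∃ s : ℕ, s < m ∧ a = A κ (z + (s : ℤ) • unitVec κ)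
  | 0, h => by simp at h
  | m + 1, h => by
      rw [AveragingContours.segUp_succ, List.mem_append, List.mem_singleton] at h
      rcases h with h | h
      · obtain ⟨s, hs, hsa⟩ := mem_segUp_range h
        exact ⟨s, by omega, hsa⟩
      · exact ⟨m, by omega, h⟩

/-- [folklore] Letters of a backward segment with their parameter: `a = −A κ (z − (s+1)•e_κ)` with `s < m`. -/
theorem mem_segDown_range {A : Form1 4 ℝ} {z : Site 4} {κ : Fin 4} {a : ℝ} :
    ∀ {m : ℕ}, a ∈ segDown A z κ m → ∃ s : ℕ, s < m ∧ a = -A κ (z - ((s : ℤ) + 1) • unitVec κ)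
  | 0, h => by simp at h
  | m + 1, h => by
      rw [AveragingContours.segDown_succ, List.mem_append, List.mem_singleton] at h
      rcases h with h | h
      · obtain ⟨s, hs, hsa⟩ := mem_segDown_range h
        exact ⟨s, by omega, hsa⟩
      · exact ⟨m, by omega, h⟩

/-- [folklore] Letters of the signed segment from `z` of signed length `ℓ` in direction `κ`: `±A κ v` with `v_j = z_j` off `κ` and `v_κ`
between `z_κ` and `z_κ + ℓ` (half-open at the far end). -/
theorem mem_seg_between {A : Form1 4 ℝ} {z : Site 4} {κ : Fin 4} {ℓ : ℤ} {a : ℝ} (h : a ∈ seg A z κ ℓ) :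
    ∃ v : Site 4, (a = A κ v ∨ a = -A κ v) ∧ (∀ j : Fin 4, j ≠ κ → v j = z j) ∧
      min (z κ) (z κ + ℓ) ≤ v κ ∧ v κ ≤ max (z κ) (z κ + ℓ) := by
  unfold seg at h
  split_ifs at h with hℓ
  · obtain ⟨s, hs, hsa⟩ := mem_segUp_range h
    have hs' : (s : ℤ) < ℓ := by
      have : (s : ℤ) < (ℓ.toNat : ℤ) := by exact_mod_cast hs
      rwa [Int.toNat_of_nonneg hℓ] at this
    refine ⟨_, Or.inl hsa, fun j hj => by simp [unitVec_apply, hj], ?_, ?_⟩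
    · simp only [Pi.add_apply, Pi.smul_apply, unitVec_apply, if_true, smul_eq_mul, mul_one]
      exact min_le_of_left_le (by omega)
    · simp only [Pi.add_apply, Pi.smul_apply, unitVec_apply, if_true, smul_eq_mul, mul_one]
      exact le_max_of_le_right (by omega)
  · obtain ⟨s, hs, hsa⟩ := mem_segDown_range h
    have hs' : (s : ℤ) < -ℓ := by
      have : (s : ℤ) < ((-ℓ).toNat : ℤ) := by exact_mod_cast hs
      rwa [Int.toNat_of_nonneg (by omega)] at this
    refine ⟨_, Or.inr hsa, fun j hj => by simp [unitVec_apply, hj], ?_, ?_⟩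
    · simp only [Pi.sub_apply, Pi.smul_apply, unitVec_apply, if_true, smul_eq_mul, mul_one]
      exact min_le_of_right_le (by omega)
    · simp only [Pi.sub_apply, Pi.smul_apply, unitVec_apply, if_true, smul_eq_mul, mul_one]
      exact le_max_of_le_left (by omega)

/-- [folklore] **RANGE-AWARE LETTER LEMMA**: every letter of `axialAux A y x m` is `±A κ v` at a site `v` lying coordinatewise BETWEEN the
root `y` and the endpoint `x`. -/
theorem mem_axialAux_between {A : Form1 4 ℝ} {y x : Site 4} {a : ℝ} :
    ∀ m, a ∈ axialAux A y x m → ∃ (κ : Fin 4) (v : Site 4), (a = A κ v ∨ a = -A κ v) ∧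
      ∀ j : Fin 4, min (y j) (x j) ≤ v j ∧ v j ≤ max (y j) (x j)
  | 0, h => by simp [axialAux] at h
  | m + 1, h => by
      simp only [axialAux, List.mem_append] at h
      rcases h with h | h
      · split_ifs at h with hm
        · obtain ⟨v, hv, hvj, hlo, hhi⟩ := mem_seg_between h
          refine ⟨⟨m, hm⟩, v, hv, fun j => ?_⟩
          have hc : ∀ j : Fin 4, corner y x (m + 1) j = if m + 1 ≤ (j : ℕ) then x j else y j := fun j => rfl
          by_cases hj : j = ⟨m, hm⟩
          · subst hj
            have hcm : corner y x (m + 1) ⟨m, hm⟩ = y ⟨m, hm⟩ := by rw [hc, if_neg (by simp)]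
            rw [hcm, add_sub_cancel] at hlo hhi
            exact ⟨hlo, hhi⟩
          · rw [hvj j hj, hc]
            split_ifs
            · exact ⟨min_le_right _ _, le_max_right _ _⟩
            · exact ⟨min_le_left _ _, le_max_left _ _⟩
        · simp at h
      · exact mem_axialAux_between m h

/-- [folklore] The same for the full contour. -/
theorem mem_axial_between {A : Form1 4 ℝ} {y x : Site 4} {a : ℝ} (h : a ∈ axial A y x) :
    ∃ (κ : Fin 4) (v : Site 4), (a = A κ v ∨ a = -A κ v) ∧ ∀ j : Fin 4, min (y j) (x j) ≤ v j ∧ v j ≤ max (y j) (x j) :=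
  mem_axialAux_between 4 h

variable (n : ℕ) [NeZero n]

/-- [folklore] Floor division by the block side is monotone: a site coordinatewise between two sites of block `Y` lies in block `Y`. -/
theorem blk_of_between {y x v : Site 4} {Y : Site 4} (hy : blk (n - 1) y = Y) (hx : blk (n - 1) x = Y)
    (hv : ∀ j : Fin 4, min (y j) (x j) ≤ v j ∧ v j ≤ max (y j) (x j)) : blk (n - 1) v = Y := by
  have hn : (0 : ℤ) < n := by exact_mod_cast Nat.pos_of_ne_zero (NeZero.ne n)
  funext j
  have hyj : y j / (n : ℤ) = Y j := by rw [← blk_pred_apply n y j, hy]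
  have hxj : x j / (n : ℤ) = Y j := by rw [← blk_pred_apply n x j, hx]
  rw [blk_pred_apply]
  obtain ⟨hlo, hhi⟩ := hv j
  have hmax : max (y j) (x j) / (n : ℤ) = Y j := by
    rcases le_total (y j) (x j) with h | h
    · rw [max_eq_right h, hxj]
    · rw [max_eq_left h, hyj]
  have hmin : min (y j) (x j) / (n : ℤ) = Y j := by
    rcases le_total (y j) (x j) with h | h
    · rw [min_eq_left h, hyj]
    · rw [min_eq_right h, hxj]
  apply le_antisymm
  · calc v j / (n : ℤ) ≤ max (y j) (x j) / (n : ℤ) := Int.ediv_le_ediv hn hhi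
      _ = Y j := hmax
  · calc Y j = min (y j) (x j) / (n : ℤ) := hmin.symm
      _ ≤ v j / (n : ℤ) := Int.ediv_le_ediv hn hlo

/-- [folklore] The corner `n•Y` lies in block `Y`. -/
theorem blk_corner (Y : Site 4) : blk (n - 1) ((n : ℤ) • Y) = Y := by
  have h := blk_translate' n (0 : Site 4) Y
  rwa [zero_add, blk_zero, zero_add] at h

/-- [folklore] **A BOND OUTSIDE THE BLOCK IS NEVER ON THE BLOCK's CORNER CONTOUR**: if `blk w = Y` and `blk v ≠ Y`, the bond `⟨v, v+e_κ⟩` has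
signed multiplicity `0` in `Γ_{n•Y, w}`. -/
theorem gammaCoeff_eq_zero_of_blk_ne (κ : Fin 4) {v w Y : Site 4} (hw : blk (n - 1) w = Y) (hv : blk (n - 1) v ≠ Y) :
    gammaCoeff κ v ((n : ℤ) • Y) w = 0 := by
  unfold gammaCoeff
  refine List.sum_eq_zero fun a ha => ?_
  obtain ⟨κ₁, v₁, hav, hbetween⟩ := mem_axial_between ha
  have hv₁ : blk (n - 1) v₁ = Y := blk_of_between n (blk_corner n Y) hw hbetween
  have h0 : bondForm κ v κ₁ v₁ = 0 := by
    unfold bondForm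
    rw [if_neg]
    rintro ⟨-, h⟩
    exact hv (by rw [← h, hv₁])
  rcases hav with h | h
  · rw [h, h0]
  · rw [h, h0, neg_zero]

/-- [folklore] **T6's OWED GUARD-REDUNDANCY LEMMA**: the `[blk v = Y]` guard of `qJet` is automatic —
`qJet n κ v Y w = [blk w = Y]·(n⁴)⁻¹·γ(κ, v; n•Y, w)`. -/
theorem qJet_eq_unguarded (κ : Fin 4) (v Y w : Site 4) :
    qJet n κ v Y w = if blk (n - 1) w = Y then ((n : ℝ) ^ 4)⁻¹ * gammaCoeff κ v ((n : ℤ) • Y) w else 0 := by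
  unfold qJet
  by_cases hw : blk (n - 1) w = Y
  · by_cases hv : blk (n - 1) v = Y
    · rw [if_pos ⟨hw, hv⟩, if_pos hw]
    · rw [if_neg (fun h => hv h.2), if_pos hw, gammaCoeff_eq_zero_of_blk_ne n κ hw hv, mul_zero]
  · rw [if_neg (fun h => hw h.1), if_neg hw]

/-! ## §2 Linearity of contour sums; the boundary identity for the pure-gauge combination -/

omit [NeZero n] in
/-- [folklore] Contour sums are additive in the form (from an1's `axial_sum_sub`). -/
theorem axial_sum_add (A A' : Form1 4 ℝ) (y x : Site 4) : (axial (A + A') y x).sum = (axial A y x).sum + (axial A' y x).sum := by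
  have h := axial_sum_sub (A + A') A' y x
  rw [add_sub_cancel_right] at h
  linarith

omit [NeZero n] in
/-- [folklore] The contour sum of the zero form vanishes. -/
theorem axial_sum_zero (y x : Site 4) : (axial (0 : Form1 4 ℝ) y x).sum = 0 := by
  have h := axial_sum_sub (0 : Form1 4 ℝ) 0 y x
  rw [sub_zero] at h
  linarith

omit [NeZero n] in
/-- [folklore] Contour sums commute with finite sums of forms. -/
theorem axial_sum_finset_sum {ι : Type*} (s : Finset ι) (A : ι → Form1 4 ℝ) (y x : Site 4) :
    (axial (∑ i ∈ s, A i) y x).sum = ∑ i ∈ s, (axial (A i) y x).sum := by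
  classical
  induction s using Finset.induction_on with
  | empty => rw [Finset.sum_empty, Finset.sum_empty, axial_sum_zero]
  | insert i s hi ih => rw [Finset.sum_insert hi, Finset.sum_insert hi, axial_sum_add, ih]

omit [NeZero n] in
/-- [folklore] **THE PURE-GAUGE COMBINATION OF THE BOND INDICATORS AT `u` IS THE GRADIENT OF THE SITE INDICATOR**:
`Σ_μ (bondForm μ (u − e_μ) − bondForm μ u) = grad δ_u`, `δ_u v = [v = u]`. -/
theorem sum_bondForm_div (u : Site 4) :
    (∑ μ : Fin 4, (bondForm μ (u - unitVec μ) - bondForm μ u)) = grad (fun v : Site 4 => if v = u then (1 : ℝ) else 0) := by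
  funext κ w
  rw [Finset.sum_apply, Finset.sum_apply,
    Finset.sum_eq_single κ (fun μ _ hμ => by
      rw [Pi.sub_apply, Pi.sub_apply]
      unfold bondForm
      rw [if_neg (fun h => hμ h.1.symm), if_neg (fun h => hμ h.1.symm), sub_zero]) (fun h => absurd (Finset.mem_univ _) h)]
  rw [Pi.sub_apply, Pi.sub_apply]
  unfold bondForm grad
  simp only [true_and, eq_sub_iff_add_eq]

omit [NeZero n] in
/-- [folklore] **SIGNED ENTRIES MINUS EXITS**: along ANY axial contour `Γ_{r,w}`,
`Σ_μ (γ(μ, u − e_μ; r, w) − γ(μ, u; r, w)) = [w = u] − [r = u]` (an1's telescoping `axial_sum_grad` for the site indicator). -/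
theorem sum_gammaCoeff_div (u r w : Site 4) :
    (∑ μ : Fin 4, (gammaCoeff μ (u - unitVec μ) r w - gammaCoeff μ u r w))
      = (if w = u then (1 : ℝ) else 0) - (if r = u then 1 else 0) := by
  have h : ∀ μ : Fin 4, gammaCoeff μ (u - unitVec μ) r w - gammaCoeff μ u r w
      = (axial (bondForm μ (u - unitVec μ) - bondForm μ u) r w).sum := fun μ => by
    unfold gammaCoeff; rw [axial_sum_sub]
  simp_rw [h]
  rw [← axial_sum_finset_sum, sum_bondForm_div, axial_sum_grad]

/-! ## §3 The divergences of the current and of the averaging jet -/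

omit [NeZero n] in
/-- [folklore] The bond-elimination lattice vector `e μ` is T6's `unitVec μ`. -/
theorem e_eq_unitVec (μ : Fin 4) : (e μ : Site 4) = unitVec μ := rfl

omit [NeZero n] in
/-- [folklore] One direction: `ghCur μ (u−e_μ) − ghCur μ u` at `(x,z)` is `lapDir μ x u·[z = u] − [x = u]·lapDir μ u z`. -/
theorem div_ghCur_dir (μ : Fin 4) (u x z : Site 4) :
    ghCur μ (u - unitVec μ) x z () () - ghCur μ u x z () ()
      = lapDir μ x u * (if z = u then 1 else 0) - (if x = u then 1 else 0) * lapDir μ u z := by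
  have h1 : u + unitVec μ ≠ u := add_unitVec_ne_self u μ
  have h2 : u - unitVec μ ≠ u := fun h => unitVec_ne_zero μ (by simpa using h)
  have h3 : u + unitVec μ ≠ u - unitVec μ := add_unitVec_ne_sub_unitVec u μ
  have eA : ∀ y : Site 4, (u = y + unitVec μ) ↔ (y = u - unitVec μ) := fun y =>
    ⟨fun h => by rw [h, add_sub_cancel_right], fun h => by rw [h, sub_add_cancel]⟩
  have eB : ∀ y : Site 4, (u = y - unitVec μ) ↔ (y = u + unitVec μ) := fun y =>
    ⟨fun h => by rw [h, sub_add_cancel], fun h => by rw [h, add_sub_cancel_right]⟩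
  rw [ghCur_apply, ghCur_apply, sub_add_cancel]
  simp only [lapDir, e_eq_unitVec, eq_comm (a := u) (b := x), eA, eB]
  by_cases hxu : x = u
  · subst hxu
    by_cases hz1 : z = x + unitVec μ
    · subst hz1; simp [h1, h3]
    · by_cases hz2 : z = x - unitVec μ
      · subst hz2; simp [h2, h3.symm]
      · by_cases hz3 : z = x
        · subst hz3; simp [h1.symm, h2.symm]
        · simp [hz1, hz2, hz3, h1.symm, h2.symm]
  · by_cases hx1 : x = u + unitVec μ
    · subst hx1
      by_cases hz : z = u
      · subst hz; simp [h1]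
      · simp [hz, h1]
    · by_cases hx2 : x = u - unitVec μ
      · subst hx2
        by_cases hz : z = u
        · subst hz; simp [h2, h3.symm]
        · simp [hz, h2, h3.symm]
      · simp [hxu, hx1, hx2]

omit [NeZero n] in
/-- [folklore] **DIVERGENCE OF THE CURRENT**: `Σ_μ (ghCur μ (u−e_μ) − ghCur μ u)(x,z) = lapKer x u·[z = u] − [x = u]·lapKer u z`
(= `((−Δ) ∘ δ_u − δ_u ∘ (−Δ))(x,z)`). -/
theorem div_ghCur_apply (u x z : Site 4) :
    (∑ μ : Fin 4, (ghCur μ (u - unitVec μ) x z () () - ghCur μ u x z () ()))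
      = lapKer x u * (if z = u then 1 else 0) - (if x = u then 1 else 0) * lapKer u z := by
  simp only [div_ghCur_dir, lapKer, Finset.sum_mul, Finset.mul_sum, Finset.sum_sub_distrib]

/-- [folklore] The telescoped block sum: `Σ_μ (qJet n μ (u−e_μ) Y w − qJet n μ u Y w) = [blk w = Y]·(n⁴)⁻¹·([w = u] − [n•Y = u])`. -/
theorem sum_qJet_div (u Y w : Site 4) :
    (∑ μ : Fin 4, (qJet n μ (u - unitVec μ) Y w - qJet n μ u Y w))
      = if blk (n - 1) w = Y then ((n : ℝ) ^ 4)⁻¹ * ((if w = u then (1 : ℝ) else 0) - (if (n : ℤ) • Y = u then 1 else 0)) else 0 := by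
  simp only [qJet_eq_unguarded]
  by_cases hw : blk (n - 1) w = Y
  · simp only [if_pos hw, ← mul_sub, ← Finset.mul_sum, sum_gammaCoeff_div]
  · simp only [if_neg hw, sub_zero, Finset.sum_const_zero]

/-- [folklore] **DIVERGENCE OF THE AVERAGING JET** (any block size, corner root — the root terms cancel in the antisymmetrisation):
`Σ_μ (qAnti n μ (u−e_μ) − qAnti n μ u)(x,z) = (n⁴)⁻¹·(sameBlk x u·[z = u] − [x = u]·sameBlk u z)`. -/
theorem div_qAnti_apply (u x z : Site 4) :
    (∑ μ : Fin 4, (qAnti n μ (u - unitVec μ) x z () () - qAnti n μ u x z () ()))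
      = ((n : ℝ) ^ 4)⁻¹ * (sameBlk (n - 1) x u * (if z = u then 1 else 0) - (if x = u then 1 else 0) * sameBlk (n - 1) u z) := by
  have hsplit : (∑ μ : Fin 4, (qAnti n μ (u - unitVec μ) x z () () - qAnti n μ u x z () ()))
      = (∑ μ : Fin 4, (qJet n μ (u - unitVec μ) (blk (n - 1) x) z - qJet n μ u (blk (n - 1) x) z))
        - ∑ μ : Fin 4, (qJet n μ (u - unitVec μ) (blk (n - 1) z) x - qJet n μ u (blk (n - 1) z) x) := by
    rw [← Finset.sum_sub_distrib]
    refine Finset.sum_congr rfl fun μ _ => ?_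
    rw [qAnti_apply, qAnti_apply]
    ring
  rw [hsplit, sum_qJet_div, sum_qJet_div]
  unfold sameBlk
  by_cases hb : blk (n - 1) x = blk (n - 1) z
  · rw [if_pos hb.symm, if_pos hb, hb]
    by_cases hzu : z = u
    · subst hzu
      simp only [if_true]
      ring
    · rw [if_neg hzu, mul_zero, zero_sub, zero_sub]
      by_cases hxu : x = u
      · subst hxu
        rw [if_pos rfl, if_pos hb]; ring
      · rw [if_neg hxu]; ring
  · have hb' : ¬(blk (n - 1) z = blk (n - 1) x) := fun h => hb h.symm
    rw [if_neg hb', if_neg hb, sub_zero]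
    by_cases hzu : z = u
    · subst hzu
      rw [if_neg hb, zero_mul, zero_sub]
      by_cases hxz : x = z
      · exact absurd (congrArg (blk (n - 1)) hxz) hb
      · rw [if_neg hxz, zero_mul, neg_zero, mul_zero]
    · rw [if_neg hzu, mul_zero, zero_sub]
      by_cases hxu : x = u
      · subst hxu
        rw [if_neg hb, if_pos rfl, one_mul, neg_zero, mul_zero]
      · rw [if_neg hxu, zero_mul, neg_zero, mul_zero]

/-! ## §4 The ghost operator's kernel and the divergence of the T6 stencil as a commutator -/

/-- [our object] **THE GHOST OPERATOR's KERNEL** in the road's `MKer 4 Unit` currency: `Oker n a x z := AX (n−1) a x z` — the site matrix of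
`Δ^η + a·Q′*Q′` at block side `n` (`GhostLeg.AX_pred_apply`: `n²·(−Δ)(x,z) + a·n⁻⁴·1[blk x = blk z]`), whose whole-lattice inverse is T2's
`Ggh n a`.  A definition by re-indexing; asserts nothing. -/
def Oker (n : ℕ) (a : ℝ) : MKer 4 Unit := fun x z _ _ => AX (n - 1) a x z

/-- [our object] Unfolding `Oker` in road units. -/
theorem Oker_apply (a : ℝ) (x z : Site 4) (p q : Unit) :
    Oker n a x z p q = (n : ℝ) ^ 2 * lapKer x z + a / (n : ℝ) ^ 4 * sameBlk (n - 1) x z := by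
  show AX (n - 1) a x z = _
  rw [AX_pred_apply]

/-- [folklore] **THE PURE-GAUGE DIVERGENCE OF T6's STENCIL, ENTRYWISE**: at the weights `(cK, cQ) = (c·n², c·a)`,
`divV (Sgh n (c·n²) (c·a)) u (x,z) = c·(Oker x u·[z = u] − [x = u]·Oker u z)`. -/
theorem divV_Sgh_apply (a c : ℝ) (u x z : Site 4) (p q : Unit) :
    divV (Sgh n (c * (n : ℝ) ^ 2) (c * a)) u x z p q
      = c * (Oker n a x u p q * (if z = u then 1 else 0) - (if x = u then 1 else 0) * Oker n a u z p q) := by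
  obtain rfl : p = () := Subsingleton.elim _ _
  obtain rfl : q = () := Subsingleton.elim _ _
  have hn : (n : ℝ) ≠ 0 := by exact_mod_cast NeZero.ne n
  unfold divV
  simp only [Finset.sum_apply, Pi.sub_apply, Sgh_apply, unitVec_eq]
  have hre : ∀ μ : Fin 4, c * (n : ℝ) ^ 2 * ghCur μ (u - unitVec μ) x z () () + c * a * qAnti n μ (u - unitVec μ) x z () ()
      - (c * (n : ℝ) ^ 2 * ghCur μ u x z () () + c * a * qAnti n μ u x z () ())
      = c * (n : ℝ) ^ 2 * (ghCur μ (u - unitVec μ) x z () () - ghCur μ u x z () ())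
        + c * a * (qAnti n μ (u - unitVec μ) x z () () - qAnti n μ u x z () ()) := fun μ => by ring
  simp only [hre, Finset.sum_add_distrib, ← Finset.mul_sum, div_ghCur_apply, div_qAnti_apply, Oker_apply]
  field_simp
  ring

/-- [folklore] **`divV (Sgh n (c·n²) (c·a)) u = c • (Oker n a ∘ genX u − genX u ∘ Oker n a)`** — the pure-gauge combination of T6's first
jets at the fine site `u` IS the commutator of the ghost operator with the site generator (every `n ≥ 1`, `a`, `c`). -/
theorem divV_Sgh_eq (a c : ℝ) (u : Site 4) :
    divV (Sgh n (c * (n : ℝ) ^ 2) (c * a)) u = c • (comp (Oker n a) (genX u) - comp (genX u) (Oker n a)) := by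
  funext x z p q
  rw [divV_Sgh_apply, Pi.smul_apply, Pi.smul_apply, Pi.smul_apply, Pi.smul_apply, Pi.sub_apply, Pi.sub_apply, Pi.sub_apply,
    Pi.sub_apply, smul_eq_mul, comp_genX_right, comp_genX_left]

end Summit.QuantumFields.BalabanUV.Beta.D1BFx.GhostStencilDivergence

end
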